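import Mathlib
import Summits.NavierStokesRegularity.NavierStokesRegularity.Theorems.PerpetualPumpCircuitPumpTruncatedFlow
import Summits.NavierStokesRegularity.NavierStokesRegularity.Theorems.WakeRatchetTailRatchetTruncatedFlow
import HarnessLib

/-!
# `WakeRatchet.TailRatchet` (stmt-NavierStokesRegularity-21808), door R-cont, brick (R2): flows of `C¹`
# fields DEPENDING ON A PARAMETER, jointly continuous in (parameter, datum, time)

Support file for the crux `TailRatchet` (route `WakeRatchet`; MODEL lattice ODEs of Tao 2016 §1.2/§4 —
nothing here is a statement about the Navier–Stokes equations; stmt-21808 is neither proved nor refuted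
here; no stub of skeleton d00b85951d7c is closed).

Door R-cont of the census of stmt-21808 (continuation in the base `Λ` of the exact scalar dyadic front from
the lacunary end, now degree-free: `Literature.Analysis.Convex.TopologicalTransversality`) needs ONE
fixed-point formulation of the truncated one-period problem (`…TailRatchetTruncationLimit`,
`…TailRatchetTruncatedFlow.truncated_flow`) that is JOINTLY CONTINUOUS IN THE BASE.  The tree's generic flow
lemma `PerpetualPumpCircuitPump.truncatedFlow_flow` (a `C¹` field on a finite-dimensional space under an
a-priori bound has a flow jointly continuous in (datum, time)) is stated for ONE autonomous field.  This
file adds the parameter by the standard device — freeze the parameter as an extra state variable with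
zero velocity:

* `fst_eq_of_hasDerivWithinAt_zero` — a curve in `P × E` whose derivative within `[0, s]` has first
  component `0` keeps its first component;
* `parametricFlow` — for a `C¹` family `V : P × E → E` (finite-dimensional `P`, `E`) and a set `A` of
  (parameter, datum) pairs with bounded parameters such that every solution of `y' = V(p, y)` from
  `(p, a) ∈ A` on `[0, s] ⊆ [0, T]` stays in the ball `‖y‖ ≤ R`, there is `Ψ : P × E → ℝ → E`, JOINTLY
  CONTINUOUS on `(P × E) × ℝ`, with `Ψ (p,a) 0 = a` and `t ↦ Ψ (p,a) t` a solution of `y' = V(p, y)` on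
  `[0, T]` for every `(p, a) ∈ A` (apply `truncatedFlow_flow` to `(p, y)' = (0, V(p, y))`; the a-priori
  bound transfers because the parameter component is constant along solutions).

* `truncated_contDiff_param`, `truncated_flow_param` — the DYADIC case: with the log-base `ℓ = log Λ`
  as parameter (the field `Λ^{n−1}Z_{n−1}² − Λ^n Z_n Z_{n+1}`, `|n| ≤ K`, is smooth in `ℓ` through
  `Λ^n = e^{nℓ}`, all `n ∈ ℤ`) and the conserved truncated energy (`truncated_sq_le_energy`) as a-priori
  bound, the `K`-truncated inviscid dyadic lattice has a flow jointly continuous in `((ℓ, x), t)` on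
  `S × [0, Tmax]` for every set `S` of (log-base, datum) pairs with bounded `ℓ` and bounded truncated
  energy — the fixed-base `WakeRatchetLatticePeriod.truncated_flow` made continuous in the base.

HONEST FRAMING: elementary ODE bookkeeping (continuous dependence on parameters) on the lemma layer of a
MODEL-lattice programme; rung 0.
-/

noncomputable section

set_option linter.dupNamespace false

namespace Summit.NavierStokesRegularity.NavierStokesRegularity.Theorems

namespace WakeRatchetParametricFlow

open Set Metric Filter Topology
open PerpetualPumpCircuitPump

variable {P E : Type*} [NormedAddCommGroup P] [NormedSpace ℝ P] [NormedAddCommGroup E]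
  [NormedSpace ℝ E]

/-- A curve `γ : ℝ → P × E` whose derivative within `[0, s]` has vanishing first component keeps its
first component: `(γ t).1 = (γ 0).1` on `[0, s]` (mean value inequality with bound `0`). [folklore] -/
theorem fst_eq_of_hasDerivWithinAt_zero {γ : ℝ → P × E} {F : ℝ → E} {s : ℝ}
    (hγ : ∀ t ∈ Icc (0 : ℝ) s, HasDerivWithinAt γ ((0 : P), F t) (Icc 0 s) t) :
    ∀ t ∈ Icc (0 : ℝ) s, (γ t).1 = (γ 0).1 := by
  intro t ht
  have h1 : ∀ u ∈ Icc (0 : ℝ) s, HasDerivWithinAt (fun u => (γ u).1) (0 : P) (Icc 0 s) u := by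
    intro u hu
    have h := ((ContinuousLinearMap.fst ℝ P E).hasFDerivAt).comp_hasDerivWithinAt u (hγ u hu)
    simpa [Function.comp_def] using h
  have h0s : (0 : ℝ) ∈ Icc (0 : ℝ) s := left_mem_Icc.2 (ht.1.trans ht.2)
  have hle := (convex_Icc (0 : ℝ) s).norm_image_sub_le_of_norm_hasDerivWithin_le (C := 0) h1
    (fun u _ => by simp) h0s ht
  have : ‖(γ t).1 - (γ 0).1‖ ≤ 0 := by simpa using hle
  exact sub_eq_zero.1 (norm_le_zero_iff.1 this)

variable [FiniteDimensional ℝ P] [FiniteDimensional ℝ E]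

/-- **Flow of a `C¹` field depending on a parameter, jointly continuous in (parameter, datum, time).**
Let `V : P × E → E` be `C¹` (`P`, `E` finite-dimensional), `T > 0`, and let `A ⊆ P × E` be a set of
(parameter, datum) pairs with `‖p‖ ≤ R` on `A` such that every solution `β` of `β' = V(p, β)` on
`[0, s]`, `0 < s ≤ T`, with `β 0 = a`, `(p, a) ∈ A`, obeys `‖β t‖ ≤ R`.  Then there is
`Ψ : P × E → ℝ → E`, continuous on `(P × E) × ℝ`, with `Ψ (p,a) 0 = a` and
`HasDerivWithinAt (Ψ (p,a)) (V (p, Ψ (p,a) t)) [0,T] t` for all `(p,a) ∈ A`, `t ∈ [0, T]`.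
Proof: `truncatedFlow_flow` for the autonomous field `(p, y) ↦ (0, V(p, y))` on `P × E`; along its
solutions the parameter component is constant (`fst_eq_of_hasDerivWithinAt_zero`), so the a-priori bound
and the equation transfer componentwise (sup norm on the product). [folklore] -/
theorem parametricFlow {V : P × E → E} (hV : ContDiff ℝ 1 V) {A : Set (P × E)} {T R : ℝ}
    (hT : 0 < T) (hAP : ∀ q ∈ A, ‖q.1‖ ≤ R)
    (hAp : ∀ q ∈ A, ∀ s : ℝ, 0 < s → s ≤ T → ∀ β : ℝ → E, β 0 = q.2 →
      (∀ t ∈ Icc 0 s, HasDerivWithinAt β (V (q.1, β t)) (Icc 0 s) t) → ∀ t ∈ Icc 0 s, ‖β t‖ ≤ R) :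
    ∃ Ψ : P × E → ℝ → E, Continuous (fun w : (P × E) × ℝ => Ψ w.1 w.2) ∧ ∀ q ∈ A, Ψ q 0 = q.2 ∧
      ∀ t ∈ Icc 0 T, HasDerivWithinAt (Ψ q) (V (q.1, Ψ q t)) (Icc 0 T) t := by
  -- the augmented autonomous field on `P × E`
  set W : P × E → P × E := fun q => ((0 : P), V q) with hW
  have hWc : ContDiff ℝ 1 W := contDiff_const.prodMk hV
  -- a priori bound for the augmented system
  have hbound : ∀ q ∈ A, ∀ s : ℝ, 0 < s → s ≤ T → ∀ γ : ℝ → P × E, γ 0 = q →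
      (∀ t ∈ Icc 0 s, HasDerivWithinAt γ (W (γ t)) (Icc 0 s) t) → ∀ t ∈ Icc 0 s, ‖γ t‖ ≤ R := by
    intro q hq s hs hsT γ hγ0 hγ t ht
    have hγ' : ∀ u ∈ Icc (0 : ℝ) s, HasDerivWithinAt γ ((0 : P), V (γ u)) (Icc 0 s) u :=
      fun u hu => by simpa only [hW] using hγ u hu
    have hfst : ∀ u ∈ Icc (0 : ℝ) s, (γ u).1 = q.1 := fun u hu => by
      rw [fst_eq_of_hasDerivWithinAt_zero hγ' u hu, hγ0]
    have hβ : ∀ u ∈ Icc (0 : ℝ) s,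
        HasDerivWithinAt (fun u => (γ u).2) (V (q.1, (γ u).2)) (Icc 0 s) u := by
      intro u hu
      have h := ((ContinuousLinearMap.snd ℝ P E).hasFDerivAt).comp_hasDerivWithinAt u (hγ' u hu)
      have hq1 : V (γ u) = V (q.1, (γ u).2) := by rw [← hfst u hu]
      simpa [Function.comp_def, hq1] using h
    have hb := hAp q hq s hs hsT (fun u => (γ u).2) (by simp [hγ0]) hβ t ht
    rw [Prod.norm_def]
    exact max_le (by rw [hfst t ht]; exact hAP q hq) hb
  obtain ⟨Φ, hΦc, hΦ⟩ := truncatedFlow_flow hWc (A := A) (T := T) (R := R) hT hbound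
  refine ⟨fun q t => (Φ q t).2, continuous_snd.comp hΦc, fun q hq => ?_⟩
  obtain ⟨h0, hd⟩ := hΦ q hq
  have hd' : ∀ u ∈ Icc (0 : ℝ) T, HasDerivWithinAt (Φ q) ((0 : P), V (Φ q u)) (Icc 0 T) u :=
    fun u hu => by simpa only [hW] using hd u hu
  have hfst : ∀ u ∈ Icc (0 : ℝ) T, (Φ q u).1 = q.1 := fun u hu => by
    rw [fst_eq_of_hasDerivWithinAt_zero hd' u hu, h0]
  refine ⟨by simp only [h0], fun t ht => ?_⟩
  have h := ((ContinuousLinearMap.snd ℝ P E).hasFDerivAt).comp_hasDerivWithinAt t (hd' t ht)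
  have hq1 : V (Φ q t) = V (q.1, (Φ q t).2) := by rw [← hfst t ht]
  simpa [Function.comp_def, hq1] using h

/-! ## The `K`-truncated dyadic lattice: flow jointly continuous in (base, datum, time) -/

section Dyadic

open Finset WakeRatchetLatticePeriod

/-- The truncated dyadic field at base `Λ = e^ℓ`, as a function of `(ℓ, y) ∈ ℝ × (Icc (-K) K → ℝ)`, is
`C¹` (polynomial in the coordinates, `Λ^n = e^{nℓ}` smooth in `ℓ` for every `n ∈ ℤ`). [elementary] -/
theorem truncated_contDiff_param (K : ℕ) :
    ContDiff ℝ 1 (fun (q : ℝ × (↥(Set.Icc (-(K : ℤ)) (K : ℤ)) → ℝ))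
        (k : ↥(Set.Icc (-(K : ℤ)) (K : ℤ))) =>
      Real.exp q.1 ^ ((k : ℤ) - 1) *
          (if h : |(k : ℤ) - 1| ≤ (K : ℤ) then q.2 ⟨(k : ℤ) - 1, abs_le.1 h⟩ else 0) ^ 2 -
        Real.exp q.1 ^ (k : ℤ) * (if h : |(k : ℤ)| ≤ (K : ℤ) then q.2 ⟨(k : ℤ), abs_le.1 h⟩ else 0) *
          (if h : |(k : ℤ) + 1| ≤ (K : ℤ) then q.2 ⟨(k : ℤ) + 1, abs_le.1 h⟩ else 0)) := by
  have hc : ∀ n' : ℤ, ContDiff ℝ 1 (fun q : ℝ × (↥(Set.Icc (-(K : ℤ)) (K : ℤ)) → ℝ) =>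
      if h : |n'| ≤ (K : ℤ) then q.2 ⟨n', abs_le.1 h⟩ else 0) := by
    intro n'
    by_cases h : |n'| ≤ (K : ℤ)
    · simp only [dif_pos h]
      exact (contDiff_apply ℝ ℝ (⟨n', abs_le.1 h⟩ : ↥(Set.Icc (-(K : ℤ)) (K : ℤ)))).comp contDiff_snd
    · simp only [dif_neg h]
      exact contDiff_const
  have hexp : ∀ n' : ℤ, ContDiff ℝ 1 (fun q : ℝ × (↥(Set.Icc (-(K : ℤ)) (K : ℤ)) → ℝ) =>
      Real.exp q.1 ^ n') := by
    intro n'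
    have h1 : (fun q : ℝ × (↥(Set.Icc (-(K : ℤ)) (K : ℤ)) → ℝ) => Real.exp q.1 ^ n') =
        fun q => Real.exp ((n' : ℝ) * q.1) :=
      funext fun q => by rw [← Real.rpow_intCast, ← Real.exp_mul, mul_comm]
    rw [h1]
    exact Real.contDiff_exp.comp (contDiff_const.mul contDiff_fst)
  refine contDiff_pi.2 fun k => ?_
  exact ((hexp _).mul ((hc _).pow 2)).sub (((hexp _).mul (hc _)).mul (hc _))

/-- **Flow of the `K`-truncated inviscid dyadic lattice, jointly continuous in (BASE, datum, time).**  For a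
set `S` of pairs `(ℓ, x)` — log-base `ℓ` (base `Λ = e^ℓ > 0`) with `|ℓ| ≤ ℓmax`, datum `x` vanishing off
`|n| ≤ K` with truncated energy `Σ_{|n|≤K} x_n² ≤ R₀²` — and every `Tmax > 0` there is a flow map
`Φ : ℓ → datum → time → state` solving `Ż_n = Λ^{n-1}Z_{n-1}² − Λ^n Z_n Z_{n+1}` (`|n| ≤ K`; frozen at `0`
outside) on `[0, Tmax]` from every `(ℓ, x) ∈ S`, jointly continuous in `((ℓ, x), t) ∈ S × [0, Tmax]`
coordinatewise.  (The tree's `WakeRatchetLatticePeriod.truncated_flow` is the fixed-base case; the a-priori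
bound is the conserved truncated energy `truncated_sq_le_energy`, the flow is `parametricFlow` for the field
`truncated_contDiff_param`.)  This is the joint continuity in the base that a continuation in `Λ` of
truncated one-period witnesses (`…TailRatchetTruncationLimit`) consumes.
[folklore; cite: Tao2016AveragedNS, §1.2] -/
theorem truncated_flow_param (K : ℕ) {Tmax ℓmax : ℝ} (R₀ : ℝ) (S : Set (ℝ × (ℤ → ℝ))) (hTmax : 0 < Tmax)
    (hℓ : ∀ q ∈ S, |q.1| ≤ ℓmax)
    (hS : ∀ q ∈ S, ∀ n : ℤ, (K : ℤ) < |n| → q.2 n = 0)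
    (hR : ∀ q ∈ S, ∑ j ∈ range (2 * K + 1), q.2 ((j : ℤ) - K) ^ 2 ≤ R₀ ^ 2) :
    ∃ Φ : ℝ × (ℤ → ℝ) → ℝ → (ℤ → ℝ),
      (∀ q ∈ S,
        (∀ n : ℤ, Φ q 0 n = q.2 n) ∧
        (∀ n : ℤ, (K : ℤ) < |n| → ∀ t ∈ Set.Icc (0 : ℝ) Tmax, Φ q t n = 0) ∧
        (∀ n : ℤ, |n| ≤ (K : ℤ) → ∀ t ∈ Set.Icc (0 : ℝ) Tmax,
          HasDerivWithinAt (fun s => Φ q s n)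
            (Real.exp q.1 ^ (n - 1) * Φ q t (n - 1) ^ 2 - Real.exp q.1 ^ n * Φ q t n * Φ q t (n + 1))
            (Set.Icc (0 : ℝ) Tmax) t)) ∧
      (∀ n : ℤ, ContinuousOn (fun p : (ℝ × (ℤ → ℝ)) × ℝ => Φ p.1 p.2 n) (S ×ˢ Set.Icc (0 : ℝ) Tmax)) := by
  have hR0 : 0 ≤ |R₀| := abs_nonneg _
  set R : ℝ := max |R₀| |ℓmax| with hRdef
  -- transport of data to `E`
  set ι : ℝ × (ℤ → ℝ) → ℝ × (↥(Set.Icc (-(K : ℤ)) (K : ℤ)) → ℝ) :=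
    fun q => (q.1, fun k => q.2 k) with hιdef
  have hflow := parametricFlow (truncated_contDiff_param K) (A := ι '' S) (T := Tmax) (R := R) hTmax
  refine (hflow ?_ ?_).elim fun Ψ hΨ' => ?_
  · -- bounded parameters
    rintro _ ⟨q, hq, rfl⟩
    simp only [hιdef, Real.norm_eq_abs]
    exact ((hℓ q hq).trans (le_abs_self _)).trans (le_max_right _ _)
  · -- the a priori bound, transported to `E`: energy conservation at base `e^ℓ`
    rintro _ ⟨q, hq, rfl⟩ s hs hsT β hβ0 hβ t ht
    simp only [hιdef] at hβ0 hβ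
    set Z : ℤ → ℝ → ℝ :=
      fun n τ => if h : |n| ≤ (K : ℤ) then β τ ⟨n, abs_le.1 h⟩ else 0 with hZ
    have h1 : ∀ n : ℤ, Z n 0 = q.2 n := by
      intro n
      by_cases hn : |n| ≤ (K : ℤ)
      · simp only [hZ, dif_pos hn, hβ0]
      · simp only [hZ, dif_neg hn]
        exact (hS q hq n (not_le.1 hn)).symm
    have h2 : ∀ n : ℤ, (K : ℤ) < |n| → ∀ τ ∈ Set.Icc (0 : ℝ) s, Z n τ = 0 :=
      fun n hn τ _ => by simp only [hZ, dif_neg (not_le.2 hn)]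
    have h3 : ∀ n : ℤ, |n| ≤ (K : ℤ) → ∀ τ ∈ Set.Icc (0 : ℝ) s,
        HasDerivWithinAt (Z n) (Real.exp q.1 ^ (n - 1) * Z (n - 1) τ ^ 2 -
          Real.exp q.1 ^ n * Z n τ * Z (n + 1) τ) (Set.Icc (0 : ℝ) s) τ := by
      intro n hn τ hτ
      have hd := hasDerivWithinAt_pi.1 (hβ τ hτ) ⟨n, abs_le.1 hn⟩
      simp only [hZ, dif_pos hn] at hd ⊢
      exact hd
    rw [pi_norm_le_iff_of_nonneg (hR0.trans (le_max_left _ _))]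
    intro k
    have hk : |(k : ℤ)| ≤ (K : ℤ) := abs_le.2 (Set.mem_Icc.1 k.2)
    have hsq := truncated_sq_le_energy h3 h2 (k : ℤ) t ht
    have hZk : Z k t = β t k := by simp only [hZ, dif_pos hk]
    rw [hZk] at hsq
    simp only [h1] at hsq
    rw [Real.norm_eq_abs]
    exact (sq_le_sq.1 (hsq.trans (hR q hq))).trans (le_max_left _ _)
  · -- the flow, transported back to the lattice
    obtain ⟨hΨc, hΨ⟩ := hΨ'
    refine ⟨fun q t n => if h : |n| ≤ (K : ℤ) then Ψ (ι q) t ⟨n, abs_le.1 h⟩ else 0,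
      fun q hq => ?_, fun n => ?_⟩
    · obtain ⟨h0, hd⟩ := hΨ _ ⟨q, hq, rfl⟩
      refine ⟨fun n => ?_, fun n hn t _ => by simp only [dif_neg (not_le.2 hn)], fun n hn t ht => ?_⟩
      · by_cases hn : |n| ≤ (K : ℤ)
        · simp only [dif_pos hn]
          rw [h0]
        · simp only [dif_neg hn]
          exact (hS q hq n (not_le.1 hn)).symm
      · have h1 := hasDerivWithinAt_pi.1 (hd t ht) ⟨n, abs_le.1 hn⟩
        simp only [dif_pos hn, hιdef] at h1 ⊢
        exact h1
    · by_cases hn : |n| ≤ (K : ℤ)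
      · simp only [dif_pos hn]
        have hr : Continuous (fun p : (ℝ × (ℤ → ℝ)) × ℝ => (ι p.1, p.2)) := by
          refine (Continuous.prodMk ?_ ?_).prodMk continuous_snd
          · exact continuous_fst.comp continuous_fst
          · refine continuous_pi fun k => ?_
            exact (continuous_apply (k : ℤ)).comp (continuous_snd.comp continuous_fst)
        exact ((continuous_apply _).comp (hΨc.comp hr)).continuousOn
      · simpa only [dif_neg hn] using continuousOn_const

end Dyadic

end WakeRatchetParametricFlow

end Summit.NavierStokesRegularity.NavierStokesRegularity.Theorems

end
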